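import Literature.Algebra.Polynomial.FischerDecomposition
import Mathlib
import HarnessLib

/-!
# Route `F4SubCurvatureDoor`, crux ⟨stmt-QuantumFields-23125⟩ `RationalToGeneral`: LINE g18-A v5 «top-channel cone cut»
# (planner `ym-idea-3` g18, tree skeleton `Cruxes/RationalToGeneral/Lines/sextic_channel.lean` commit 9dfcf5fb94f6) —
# the content of the registered stub `stub_nullConePointedness`, SPELLED OUT and DEF-FREE

**Theorem** (`eq_zero_of_laplacian_eq_zero_of_aeval_nullMomentum_eq_zero`, null-cone pointedness).  A real polynomial
`P ∈ ℝ[x₀, x₁, x₂, x₃]` with `ΔP = Σᵢ ∂ᵢ²P = 0` which vanishes at every forward null momentum `(i‖q⃗‖, q⃗)`, `q⃗ ∈ ℝ³`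
(complex evaluation), is the zero polynomial.  Homogeneity (assumed in the skeleton's `NullConePointedness`) is not needed.

Proof (as in the skeleton's docstring, made division-free):
* `exists_nullForm_decomposition` — every `P` is `(Σᵢ Xᵢ²)·Q + ρR₀ + X₀·ρR₁` with `R₀, R₁ ∈ ℝ[q₁,q₂,q₃]` and `ρ = rename Fin.succ`
  (induction on `P`; the step `·X₀` uses `X₀² = Σᵢ Xᵢ² − ρ(Σⱼ Xⱼ²)`);
* at the null momentum the form `Σᵢ Xᵢ²` evaluates to `(i‖q⃗‖)² + ‖q⃗‖² = 0` (`aeval_nullMomentum_nullForm`), and `ρR` to the real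
  number `R(q⃗)` (`aeval_nullMomentum_rename`), so the hypothesis reads `R₀(q⃗) + i‖q⃗‖·R₁(q⃗) = 0`, i.e. `R₀(q⃗) = 0` and
  `‖q⃗‖²·R₁(q⃗) = 0` for all real `q⃗`; hence `R₀ = 0` and `(Σⱼ Xⱼ²)·R₁ = 0`, so `R₁ = 0` (`MvPolynomial.funext`, `ℝ[q]` a domain);
* therefore `P = (Σᵢ Xᵢ²)·Q` lies in the ideal of `r²`, and it is `{r²}`-harmonic for the operator calculus `D` of the tree's
  Fischer file (`D(Σᵢ Xᵢ²) = Δ`); the tree theorem `Literature.Algebra.Polynomial.FischerDecomposition.disjoint_harmonic_span`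
  (`ℋ ∩ 𝒫·r² = 0`, Goodman–Wallach Lemma 5.1.5) gives `P = 0`.

Mathlib + the tree's Fischer decomposition; THEOREMS ONLY (no definitions); no named facts; no `sorry`; default heartbeats.
HONEST FRAMING: classical algebra serving support stub `NullConePointedness` of an OPEN line; nothing about the wall T1″
(`AnalyticFiniteType`), C3, crux 23125 / 23035, rung R2d or the summit is proved here; the Yang–Mills mass gap is NOT proved.
Width seat `ym-line-sfw-p2-w3` g34 (cell ym-idea-1, free hands; announced on the owner's bus 2026-08-29T03:16Z),
`--supports stmt-QuantumFields-23125`. [cite: GoodmanWallachGTM255, §5.1.2 Lemma 5.1.5]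
-/

set_option autoImplicit false

namespace Summit.QuantumFields.YangMills.Theorems.F4SubCurvatureDoorNullCone

open MvPolynomial
open scoped BigOperators

/-- The null form splits off the time variable: `Σᵢ Xᵢ² = X₀² + ρ(Σⱼ Xⱼ²)` with `ρ = rename Fin.succ`. [folklore] -/
theorem nullForm_eq_sq_add_rename :
    (∑ i : Fin 4, X i ^ 2 : MvPolynomial (Fin 4) ℝ) =
      X 0 ^ 2 + rename Fin.succ (∑ j : Fin 3, X j ^ 2 : MvPolynomial (Fin 3) ℝ) := by
  rw [Fin.sum_univ_succ, map_sum]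
  simp only [map_pow, rename_X]

/-- **Division by the null form.**  Every real polynomial in four variables is
`(Σᵢ Xᵢ²)·Q + ρR₀ + X₀·ρR₁` with `R₀, R₁` polynomials in the three space variables (`ρ = rename Fin.succ`). [folklore] -/
theorem exists_nullForm_decomposition (P : MvPolynomial (Fin 4) ℝ) :
    ∃ (Q : MvPolynomial (Fin 4) ℝ) (R₀ R₁ : MvPolynomial (Fin 3) ℝ),
      P = (∑ i : Fin 4, X i ^ 2) * Q + rename Fin.succ R₀ + X 0 * rename Fin.succ R₁ := by
  induction P using MvPolynomial.induction_on with
  | C a => exact ⟨0, C a, 0, by simp⟩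
  | add p p' hp hp' =>
    obtain ⟨Q, R₀, R₁, rfl⟩ := hp
    obtain ⟨Q', R₀', R₁', rfl⟩ := hp'
    exact ⟨Q + Q', R₀ + R₀', R₁ + R₁', by simp only [map_add]; ring⟩
  | mul_X p i hp =>
    obtain ⟨Q, R₀, R₁, rfl⟩ := hp
    rcases Fin.eq_zero_or_eq_succ i with rfl | ⟨j, rfl⟩
    · refine ⟨Q * X 0 + rename Fin.succ R₁, -((∑ j : Fin 3, X j ^ 2) * R₁), R₀, ?_⟩
      have hr := nullForm_eq_sq_add_rename
      simp only [map_neg, map_mul]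
      linear_combination (-(rename Fin.succ R₁ : MvPolynomial (Fin 4) ℝ)) * hr
    · exact ⟨Q * X j.succ, R₀ * X j, R₁ * X j, by simp only [map_mul, rename_X]; ring⟩

/-- At the forward null momentum `(i‖q⃗‖, q⃗)` the null form `Σᵢ Xᵢ²` evaluates to `(i‖q⃗‖)² + ‖q⃗‖² = 0`. [folklore] -/
theorem aeval_nullMomentum_nullForm (q : EuclideanSpace ℝ (Fin 3)) :
    aeval (Fin.cons (Complex.I * (‖q‖ : ℂ)) (fun j : Fin 3 => ((q j : ℝ) : ℂ)))
        (∑ i : Fin 4, X i ^ 2 : MvPolynomial (Fin 4) ℝ) = 0 := by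
  rw [map_sum, Fin.sum_univ_succ]
  simp only [map_pow, aeval_X, Fin.cons_zero, Fin.cons_succ]
  rw [mul_pow, Complex.I_sq, ← Complex.ofReal_pow, EuclideanSpace.real_norm_sq_eq q]
  push_cast
  ring

/-- At the forward null momentum a polynomial in the space variables alone evaluates to the REAL number `R(q⃗)`. [folklore] -/
theorem aeval_nullMomentum_rename (q : EuclideanSpace ℝ (Fin 3)) (R : MvPolynomial (Fin 3) ℝ) :
    aeval (Fin.cons (Complex.I * (‖q‖ : ℂ)) (fun j : Fin 3 => ((q j : ℝ) : ℂ))) (rename Fin.succ R) =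
      ((eval (fun j => q j) R : ℝ) : ℂ) := by
  rw [aeval_rename]
  have hcomp : ((Fin.cons (Complex.I * (‖q‖ : ℂ)) (fun j : Fin 3 => ((q j : ℝ) : ℂ)) : Fin 4 → ℂ) ∘ Fin.succ) =
      fun j : Fin 3 => ((q j : ℝ) : ℂ) := by
    funext j
    simp only [Function.comp_apply, Fin.cons_succ]
  rw [hcomp]
  induction R using MvPolynomial.induction_on with
  | C a => simp
  | add p p' hp hp' => simp only [map_add, hp, hp', Complex.ofReal_add]
  | mul_X p j hp => simp only [map_mul, hp, aeval_X, eval_X, Complex.ofReal_mul]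

/-- The operator calculus `D` of the tree's Fischer file sends the null form `Σᵢ Xᵢ²` to the Laplacian `Σᵢ ∂ᵢ²`.
[cite: GoodmanWallachGTM255, §5.1.2 Lemma 5.1.5] -/
theorem algHom_pderiv_nullForm_apply (D : MvPolynomial (Fin 4) ℝ →ₐ[ℝ] Module.End ℝ (MvPolynomial (Fin 4) ℝ))
    (hD : ∀ i, D (X i) =
      ((pderiv i : Derivation ℝ (MvPolynomial (Fin 4) ℝ) (MvPolynomial (Fin 4) ℝ)) :
        Module.End ℝ (MvPolynomial (Fin 4) ℝ)))
    (P : MvPolynomial (Fin 4) ℝ) :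
    D (∑ i : Fin 4, X i ^ 2) P = ∑ i : Fin 4, pderiv i (pderiv i P) := by
  rw [map_sum, LinearMap.sum_apply]
  refine Finset.sum_congr rfl fun i _ => ?_
  rw [map_pow, sq, Module.End.mul_apply, hD i]
  rfl

/-- **Null-cone pointedness, spelled out (def-free).**  A real polynomial on `ℝ⁴` with `Σᵢ ∂ᵢ²P = 0` that vanishes at every
forward null momentum `(i‖q⃗‖, q⃗)`, `q⃗ ∈ ℝ³`, is zero: division by the null form leaves a remainder `R₀ + X₀R₁` which the
hypothesis kills, so `r² ∣ P`, and a harmonic multiple of `r²` vanishes by the Fischer decomposition `ℋ ∩ 𝒫·r² = 0`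
(tree `disjoint_harmonic_span`).  Homogeneity is not needed. [cite: GoodmanWallachGTM255, §5.1.2 Lemma 5.1.5] -/
theorem eq_zero_of_laplacian_eq_zero_of_aeval_nullMomentum_eq_zero (P : MvPolynomial (Fin 4) ℝ)
    (hharm : ∑ i : Fin 4, pderiv i (pderiv i P) = 0)
    (hnull : ∀ q : EuclideanSpace ℝ (Fin 3),
      aeval (Fin.cons (Complex.I * (‖q‖ : ℂ)) (fun j : Fin 3 => ((q j : ℝ) : ℂ))) P = 0) :
    P = 0 := by
  obtain ⟨Q, R₀, R₁, hP⟩ := exists_nullForm_decomposition P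
  -- Step 1: the remainders vanish pointwise on `ℝ³`
  have hrem : ∀ x : Fin 3 → ℝ, eval x R₀ = 0 ∧ (∑ j, x j ^ 2) * eval x R₁ = 0 := by
    intro x
    set q : EuclideanSpace ℝ (Fin 3) := (WithLp.equiv 2 (Fin 3 → ℝ)).symm x with hq
    have hqx : (fun j => q j) = x := by
      funext j
      simp [hq]
    have h := hnull q
    rw [hP, map_add, map_add, map_mul, map_mul, aeval_nullMomentum_nullForm, zero_mul, zero_add,
      aeval_nullMomentum_rename, aeval_nullMomentum_rename, aeval_X, Fin.cons_zero, hqx] at h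
    have h' : ((eval x R₀ : ℝ) : ℂ) + ((‖q‖ * eval x R₁ : ℝ) : ℂ) * Complex.I = 0 := by
      rw [← h]
      push_cast
      ring
    rw [Complex.ext_iff] at h'
    simp only [Complex.add_re, Complex.ofReal_re, Complex.mul_re, Complex.I_re, mul_zero, Complex.ofReal_im,
      Complex.I_im, sub_zero, add_zero, Complex.zero_re, Complex.add_im, Complex.mul_im, mul_one,
      zero_add, Complex.zero_im] at h'
    refine ⟨h'.1, ?_⟩
    have hn : ‖q‖ ^ 2 = ∑ j, x j ^ 2 := by
      rw [EuclideanSpace.real_norm_sq_eq, ← hqx]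
    rw [← hn, sq, mul_assoc, h'.2, mul_zero]
  have hR₀ : R₀ = 0 := MvPolynomial.funext fun x => by rw [(hrem x).1, map_zero]
  have hR₁ : R₁ = 0 := by
    have hs : (∑ j : Fin 3, X j ^ 2 : MvPolynomial (Fin 3) ℝ) * R₁ = 0 :=
      MvPolynomial.funext fun x => by
        rw [map_mul, map_sum, map_zero]
        simp only [map_pow, eval_X]
        exact (hrem x).2
    rcases mul_eq_zero.mp hs with h | h
    · exfalso
      have h1 := congrArg (eval fun _ : Fin 3 => (1 : ℝ)) h
      simp only [map_sum, map_pow, eval_X, one_pow, Finset.sum_const, Finset.card_univ, Fintype.card_fin,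
        nsmul_eq_mul, mul_one, map_zero] at h1
      norm_num at h1
    · exact h
  -- Step 2: `P = r²·Q`
  have hPr : P = (∑ i : Fin 4, X i ^ 2) * Q := by
    rw [hP, hR₀, hR₁, map_zero, add_zero, mul_zero, add_zero]
  -- Step 3: Fischer — a harmonic polynomial in the ideal of `r²` is zero
  obtain ⟨D, hD⟩ :=
    Literature.Algebra.Polynomial.FischerDecomposition.exists_algHom_pderiv (ι := Fin 4)
  have hdisj :=
    Literature.Algebra.Polynomial.FischerDecomposition.disjoint_harmonic_span D hD
      ({∑ i : Fin 4, X i ^ 2} : Set (MvPolynomial (Fin 4) ℝ))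
  rw [Submodule.disjoint_def] at hdisj
  refine hdisj P ?_ ?_
  · simp only [Submodule.mem_iInf, Set.mem_singleton_iff]
    rintro g rfl
    rw [LinearMap.mem_ker, algHom_pderiv_nullForm_apply D hD, hharm]
  · rw [Submodule.restrictScalars_mem, hPr]
    exact Ideal.mul_mem_right _ _ (Ideal.subset_span rfl)

end Summit.QuantumFields.YangMills.Theorems.F4SubCurvatureDoorNullCone
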